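import Summits.Ventures.HodgeRepro2.T5RecordJointOutsideDiscriminant

/-!
# The joint statement as ONE `Prop` — `Joint K vp v w hmap k`

Tier-5 support N3 / §G-N4.2 (seat p3, gen 88). File 356 states README §10.5 (ii)(d) in full generality — the
lattice-model data of §N3.10.3 for `diag(1, 1, −1)` at a place `v` of `K⁺` over a place `vp` of `ℚ` AND the unramified
spectrum of the record's pair `(U(1 ⊗ H₀), K_v)` with a datum and generators supplied — as a 70-line conclusion; every
instantiation (files 358 / 359 / 360 / 361 / 363 / 364 / 365 / 366 / 368 / 369) re-elaborates that text and unifies it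
with file 356's, a cost that grows with the generality of the field (a variable CM subfield of `ℚ(ζ_m)` exceeded the
farm's wall). This file names the conclusion ONCE, in two halves:

* `JointLattice K vp v : Prop` — the lattice-model half (file 331's conclusion for `M = diag(1, 1, −1)`, verbatim);
  `jointLattice_of_notMem` — file 331 on the name: `disc K ∉ v → JointLattice K vp v`;
* `JointSpectrum K v w hmap k : Prop` — the spectrum half, DEFINED AS the type of file 355's theorem (`type_of%`, no
  re-elaboration); `jointSpectrum_of_staysPrime` — file 355 on the name;
* `Joint K vp v w hmap k : Prop := JointLattice K vp v ∧ JointSpectrum K v w hmap k` — file 356's conclusion;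
  **`joint_of_staysPrime`** — file 356 on the name: `disc K ∉ v → Joint K vp v w hmap k`.

These `Prop`s are the seat's packaging of PROVED statements of this record, not cited facts; they are `abbrev`s
(reducible) and the bridging theorems use `with_reducible exact`: at default transparency the unifier unfolds the
valuation structures first and exceeds the heartbeat budget (measured: the same term fails to unify with its own
`type_of%` at default transparency, and succeeds in 7 s at reducible transparency). Consumers state
`∃ w hmap, Joint K (vRat p) v w hmap k` and discharge it with `joint_of_staysPrime` (through `with_reducible exact`).
§8(d): uses an L-value-free non-vanishing device: NO.
-/
open Matrix NumberField NumberField.IsCMField IsDedekindDomain IsDedekindDomain.HeightOneSpectrum Module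
  MulAction
open scoped TensorProduct Pointwise
open Summit.Ventures.HodgeRepro2.T5UnitaryGroupForm Summit.Ventures.HodgeRepro2.T5UnitaryHeckeAdjoint
  Summit.Ventures.HodgeRepro2.T5HeckePermutationModule Summit.Ventures.HodgeRepro2.LevelPositivity
  Summit.Ventures.HodgeRepro2.T5LevelIdempotent Summit.Ventures.HodgeRepro2.T5StarOfInvolution
  Summit.Ventures.HodgeRepro2.T5FinitePlaceCM Summit.Ventures.HodgeRepro2.T5NonSplitPlaceUnitaryGroup
  Summit.Ventures.HodgeRepro2.T5RecordHyperspecial Summit.Ventures.HodgeRepro2.T5GlobalLatticeAlmostAll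
  Summit.Ventures.HodgeRepro2.T5HermitianThreeElements Summit.Ventures.HodgeRepro2.T5GaloisCartanThree
  Summit.Ventures.HodgeRepro2.T5InertDegreeGalois Summit.Ventures.HodgeRepro2.T5InertPlaceCompletion
  Summit.Ventures.HodgeRepro2.T5InertDegreeAdicCompletion Summit.Ventures.HodgeRepro2.T5InertSatakeTransform
  Summit.Ventures.HodgeRepro2.T5InertSatakeTransformCompletion Summit.Ventures.HodgeRepro2.T5InertUnipotentResidue
  Summit.Ventures.HodgeRepro2.T5InertSphericalSubquotient Summit.Ventures.HodgeRepro2.T5RecordSatakeCell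
  Summit.Ventures.HodgeRepro2.T5SplitPlaceUnitaryGroup Summit.Ventures.HodgeRepro2.T5FinitePlaceNormIndex
  Summit.Ventures.HodgeRepro2.T5HermitianLocalIsotropyN3 Summit.Ventures.HodgeRepro2.T5FinitePlaceSplitClassification
  Summit.Ventures.HodgeRepro2.T5InertDegreeCompletion Summit.Ventures.HodgeRepro2.T5InertPlaceCompletionCells
  Summit.Ventures.HodgeRepro2.T5RecordSatake Summit.Ventures.HodgeRepro2.T5CartanCellsDistinct
  Summit.Ventures.HodgeRepro2.T5RecordSatakeInert Summit.Ventures.HodgeRepro2.T5InertGlobalPrime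
  Summit.Ventures.HodgeRepro2.T5CMFieldSquareDatum Summit.Ventures.HodgeRepro2.T5RecordSatakeDegree
  Summit.Ventures.HodgeRepro2.T5RecordSatakeDegreeIntrinsic Summit.Ventures.HodgeRepro2.T5RecordSphericalSpectrum
  Summit.Ventures.HodgeRepro2.T5RecordSphericalSpectrumIntrinsic Summit.Ventures.HodgeRepro2.T5RecordSatakeToy
  Summit.Ventures.HodgeRepro2.T5RecordSphericalSpectrumDatumFree
  Summit.Ventures.HodgeRepro2.T5AdditiveConductor Summit.Ventures.HodgeRepro2.T5UnitaryGroupIsometry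
  Summit.Ventures.HodgeRepro2.T5ConductorDualLattice Summit.Ventures.HodgeRepro2.T5ConductorDualLatticeSplit
  Summit.Ventures.HodgeRepro2.T5SplitHermitianClass Summit.Ventures.HodgeRepro2.T5RecordLatticeModelOutsideDiscriminant
  Summit.Ventures.HodgeRepro2.T5RecordLatticeModelSeven

namespace Summit.Ventures.HodgeRepro2.T5RecordJointPredicate

universe uV

variable (K : Type*) [Field K] [NumberField K] [IsCMField K]
variable (vp : HeightOneSpectrum (𝓞 ℚ)) (v : HeightOneSpectrum (𝓞 (maximalRealSubfield K)))
  [v.asIdeal.LiesOver vp.asIdeal]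
variable (w : HeightOneSpectrum (𝓞 K)) [w.asIdeal.LiesOver v.asIdeal]
  (hmap : Ideal.map (algebraMap (𝓞 (maximalRealSubfield K)) (𝓞 K)) v.asIdeal = w.asIdeal)
variable (k : Type*) [Field k] [CharZero k] [IsAlgClosed k]

omit [IsCMField K] in
/-- **THE LATTICE-MODEL HALF OF THE JOINT STATEMENT AS ONE `Prop`** (the seat's packaging of file 331's conclusion for
`M = diag(1, 1, −1)` — not a cited fact): an unramified additive character `ψ` of `ℚ_{vp}` whose trace pull-back to
`K⁺_v` is unramified, and, for every such `ψ` and every place `w'` of `K` above `v`: `e(w'/v) = 1`, the record's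
character at `w'` is unramified and has the integers as its conductor dual, the standard lattice is self-dual for the
sesquilinear form of `diag(1, 1, −1)` under it, and likewise for the swapped pair. -/
abbrev JointLattice : Prop :=
      ((∃ ψ : AddChar (vp.adicCompletion ℚ) Circle, Continuous ψ ∧ (∃ y, ψ y ≠ 1) ∧
        conductorExp ψ (Valued.v : Valuation (vp.adicCompletion ℚ) (WithZero (Multiplicative ℤ))) = 0 ∧
        conductorExp (ψ.compAddMonoidHom
          (Algebra.trace (vp.adicCompletion ℚ) (v.adicCompletion (maximalRealSubfield K))).toAddMonoidHom)
          (Valued.v : Valuation (v.adicCompletion (maximalRealSubfield K)) (WithZero (Multiplicative ℤ))) = 0) ∧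
      ∀ (ψ : AddChar (vp.adicCompletion ℚ) Circle), Continuous ψ → (∃ y, ψ y ≠ 1) →
        conductorExp ψ (Valued.v : Valuation (vp.adicCompletion ℚ) (WithZero (Multiplicative ℤ))) = 0 →
        ∀ (w' : HeightOneSpectrum (𝓞 K)) [w'.asIdeal.LiesOver v.asIdeal],
          v.asIdeal.ramificationIdx' w'.asIdeal = 1 ∧
          conductorExp (recordChar K vp v w' ψ)
            (Valued.v : Valuation (w'.adicCompletion K) (WithZero (Multiplicative ℤ))) = 0 ∧
          (∀ x : w'.adicCompletion K,
            (∀ y : w'.adicCompletion K, Valued.v y ≤ 1 → recordChar K vp v w' ψ (x * y) = 1) ↔ Valued.v x ≤ 1) ∧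
          (∀ [StarRing (w'.adicCompletion K)],
            (∀ z : w'.adicCompletion K, IsLocalization.IsInteger (w'.adicCompletionIntegers K) z →
              IsLocalization.IsInteger (w'.adicCompletionIntegers K) (star z)) →
            ∀ x : Fin 3 → w'.adicCompletion K,
              (∀ y ∈ stdLattice (w'.adicCompletionIntegers K),
                recordChar K vp v w' ψ
                  (sesqForm (((algebraMap (𝓞 K) K).mapMatrix (Matrix.diagonal ![1, 1, -1])).map (algebraMap K (w'.adicCompletion K))) x y) = 1) ↔
                x ∈ stdLattice (w'.adicCompletionIntegers K)) ∧
          (letI := swapStarRing (w'.adicCompletion K)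
            ∀ x : Fin 3 → w'.adicCompletion K × w'.adicCompletion K,
              (∀ y : Fin 3 → w'.adicCompletion K × w'.adicCompletion K,
                (∀ i, Valued.v (y i).1 ≤ 1 ∧ Valued.v (y i).2 ≤ 1) →
                recordChar K vp v w' ψ
                    (sesqForm (pairMatrix (((algebraMap (𝓞 K) K).mapMatrix (Matrix.diagonal ![1, 1, -1])).map (algebraMap K (w'.adicCompletion K)))
                      (((algebraMap (𝓞 K) K).mapMatrix (Matrix.diagonal ![1, 1, -1])).map (algebraMap K (w'.adicCompletion K)))ᵀ) x y).1 *
                  recordChar K vp v w' ψ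
                    (sesqForm (pairMatrix (((algebraMap (𝓞 K) K).mapMatrix (Matrix.diagonal ![1, 1, -1])).map (algebraMap K (w'.adicCompletion K)))
                      (((algebraMap (𝓞 K) K).mapMatrix (Matrix.diagonal ![1, 1, -1])).map (algebraMap K (w'.adicCompletion K)))ᵀ) x y).2 = 1) ↔
                ∀ i, Valued.v (x i).1 ≤ 1 ∧ Valued.v (x i).2 ≤ 1))

omit [IsCMField K] in
/-- **File 331 on the name**: `disc K ∉ v → JointLattice K vp v`. -/
theorem jointLattice_of_notMem (h : ((discr K : ℤ) : 𝓞 (maximalRealSubfield K)) ∉ v.asIdeal) :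
    JointLattice K vp v :=
  record_lattice_model_outside_discriminant K (Matrix.diagonal ![1, 1, -1]) (isUnit_det_diagonal K) v h vp

/-- **THE SPECTRUM HALF OF THE JOINT STATEMENT AS ONE `Prop`** — DEFINED AS the type of file 355's theorem (no
re-elaboration): a datum `(θ, y)` with `θ = y²`, `ȳ ≠ y`, generators `l` of `𝓞_K` over `𝓞_{K⁺}`, a unit `u₀`, an
isomorphism `Φ : U(J₃(u₀)) ≃* U(1 ⊗ H₀)` matching the hyperspecial subgroups, a star-fixed uniformiser `ϖ'`, and: every
irreducible `K_v`-finite `ρ` with non-zero finite-dimensional `K_v`-invariants is `(inertSphericalQuot (α · N(v)⁻²)) ∘ Φ⁻¹`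
for some `α ≠ 0`. -/
abbrev JointSpectrum : Prop :=
  type_of%
    (exists_datum_generators_and_mulEquiv_forall_nonempty_equiv_inertSphericalQuot_record_gramToy_of_staysPrime.{uV, _, _}
      K v w hmap k)

/-- **File 355 on the name**: `JointSpectrum K v w hmap k`. -/
theorem jointSpectrum_of_staysPrime : JointSpectrum.{uV, _, _} K v w hmap k := by
  with_reducible
    exact exists_datum_generators_and_mulEquiv_forall_nonempty_equiv_inertSphericalQuot_record_gramToy_of_staysPrime.{uV, _, _} K v w hmap k

/-- **THE JOINT STATEMENT OF FILE 356 AS ONE `Prop`**: the lattice-model half AND the spectrum half at the same place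
`v` of `K⁺` over `vp`, with `v 𝓞_K = w`, for the algebraically closed field `k` of characteristic `0`. -/
abbrev Joint : Prop :=
  JointLattice K vp v ∧ JointSpectrum.{uV, _, _} K v w hmap k

/-- **File 356 on the name**: `disc K ∉ v → Joint K vp v w hmap k`. -/
theorem joint_of_staysPrime (h : ((discr K : ℤ) : 𝓞 (maximalRealSubfield K)) ∉ v.asIdeal) :
    Joint.{uV, _, _} K vp v w hmap k := by
  with_reducible exact ⟨jointLattice_of_notMem K vp v h, jointSpectrum_of_staysPrime.{uV, _, _} K v w hmap k⟩

end Summit.Ventures.HodgeRepro2.T5RecordJointPredicate
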